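/-
Copyright (c) 2026 the pub-hodgecm-mathlib formalisation cell (harness21).  Prover seat hodgecm-mathlib-LH4-p10 (g0), req620 Track A «(D-RAM) FOUR-FRAME» squad
(unit U3_Laws, stubs `stub_U3_stableLaw_RP ∕ _RU`; the (S-fin) line of MEMO-stableLaw-finite: THE ASSEMBLY — the fenced stable law from the frame-free model sum).  2026-09-03.
-/
import Summits.HodgeConjecture.HodgeConjecture.Theorems.F0P3cDyRamStableSumSignClasses   -- ★ p855115 (this seat): `two_mul_sum_fixedVertexCount_eq_sum_signClasses`; brings ★ p855032, ★ №1 `StableLawAt`∕`DyadicFence`, ★ #0a tokens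
import HarnessLib

/-!
# Crux `H413`, line LH4 «(D-RAM) FOUR-FRAME» road — unit U3_Laws (iii), TIER 2 SUPPORT: THE STABLE LAW FROM THE FRAME-FREE MODEL SUM (assembly of the (S-fin) line)
# `StableLawAt N₀ σ ϖ d t` — and the §S heads' `DyadicFence (StableLawAt depthOfRecord σ ϖ d t)` — follow BY NAME from two frame-free statements at the datum:
# (NI2) a `σ`-fixed unit `c` with the index-two dichotomy, and (MS) the eight-class diagonal-model sum `Σ_s C_tv(s) = 8(q^k − 1)∕(q − 1)`

Cell `hodgecm-mathlib` (D-0151), FLOOR 0, crux item H413 = `stmt-HodgeConjecture-24833`, route of record `HCCMUnconditional`; squad F0∕P3c∕LH4 (req618∕req620).  THEOREMS ONLY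
(no `def`, no instance, no notation, no `sorry`, default heartbeats); lane `--supports stmt-HodgeConjecture-24833 --as helper` (count-neutral).

WHAT IS PROVED.  For any threshold schedule `N₀` and any datum `(K, σ, ϖ, d, t)`:  if
  (NI2) there is `c` with `σ c = c`, `|c| = 1` and `∀ x, σ x = x → x ≠ 0 → (∃ z, z·σz = x) ∨ (∃ z, z·σz = c·x)` («local norm index two», with witness), and
  (MS)  for every such `c` and every element datum `(α, β; n₁, n₂, n₃)` at threshold `N₀ d` (★ #0a E), every `T ∈ GL₃` with matrix `diag(α, β, 1)`, every `k` with `2k + d = n₁+n₂+n₃+2`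
        and both vertex types `tv ∈ {0, 2}`:  `Σ_{s : Fin 3 → Bool} #{M : M a type-tv vertex lattice of (K³, diag(d_s)), T·M = M} = 8·(q^k − 1)∕(q − 1)` over `ℚ`
        (`d_s i = c` if `s i` else `1`; `q = #𝓀`) — THE FRAME-FREE FORM OF THE STABLE CENSUS LAW (S) («(S-model)»; its finite-ring form is (S-fin) of MEMO-stableLaw-finite),
then `StableLawAt N₀ σ ϖ d t` (★ №1 §1, VERBATIM) holds (`stableLawAt_of_normIndexTwo_of_modelSum`), hence `DyadicFence (StableLawAt N₀ σ ϖ d t)` (`dyadicFence_stableLawAt_of_…`).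
So the §S heads `stub_U3_stableLaw_RP ∕ _RU` (= `DyadicFence (StableLawAt depthOfRecord σ ϖ d t)` behind `d % 2 = 1 ∕ 0`) reduce BY NAME to (NI2) + (MS) at `N₀ = depthOfRecord`:
a RE-LINE of the two census-sized heads into one number-theoretic input (NI2; ★ (J3) at CM completions, L from the abstract datum) and ONE frame-free law (MS) per vertex type,
with the four-frame bookkeeping discharged here once and for all (★ p855032 steps (1)(2a), ★ p855115 step (2b)).  Nothing is claimed about (NI2) or (MS): they are BINDERS.

THE MATHEMATICS.  Unfold `StableLawAt`; the element datum makes `α, β` units (`α·σα = 1`), so `T = diag(α, β, 1) ∈ GL₃`; ★ p855115 gives `2·Σ_b n_tv(Γ_b) = Σ_s C_tv(s)`; (MS) gives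
`Σ_s C_tv(s) = 8(q^k−1)∕(q−1)`; divide by `2`.  [Rogawski1990, §4.9 Prop. 4.9.1 (a) p. 55; LanglandsShelstad1987, §1.3.]
HONEST LABEL.  Count-neutral (`--supports`); nothing printed is asserted; (MS) is the census law of record in model currency — a PROVER TARGET, not a fact; the verdict of record for
(D-RAM) stays PRINT [LanglandsShelstad1989 Thm. p. 484 ∕ Rogawski1990 Prop. 4.9.1 (a)] ∕ XL; `HC_CM` is proved only modulo the 7 printed citations (2 remaining named inputs:
hLiu418 = `stmt-HodgeConjecture-24832`, h413 = `stmt-HodgeConjecture-24833`) until rung 0 closes.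

## References
* [Rogawski1990] J. D. Rogawski, *Automorphic Representations of Unitary Groups in Three Variables*, Ann. of Math. Stud. 123 (1990), §3.6 pp. 28–29, §4.9 Prop. 4.9.1 (a) p. 55.
* [LanglandsShelstad1987] R. P. Langlands, D. Shelstad, *On the definition of transfer factors*, Math. Ann. 278 (1987), §1.3 (the classes in a stable class).
* [Serre1979] J.-P. Serre, *Local Fields*, GTM 67 (1979), Ch. V §3, Ch. XIV §3 (the local norm index of a ramified quadratic extension is two).
-/

set_option autoImplicit false

noncomputable section

namespace Summit.HodgeConjecture.HodgeConjecture.Cruxes.H413.F0P3cDyRamStableLawOfModelSum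

open Matrix
open Literature.NumberTheory.Automorphic Literature.NumberTheory.Automorphic.HermitianLattice Literature.NumberTheory.Automorphic.UnitaryGroup
open Literature.NumberTheory.Automorphic.UnitaryLatticeTree Literature.NumberTheory.Automorphic.UnitaryThreeFourFrame
open Summit.HodgeConjecture.HodgeConjecture.Cruxes.H413.F0P3cDyRamFourFrameLawDefs
open Summit.HodgeConjecture.HodgeConjecture.Cruxes.H413.F0P3cDyRamStableSumSignClasses
open scoped Valued WithZero Matrix MatrixGroups

variable {K : Type} [Field K] [Valued K ℤᵐ⁰] [CompleteSpace K] [Fintype 𝓀[K]]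

/-- **THE STABLE LAW AT A DATUM FROM (NI2) + (MS).**  `StableLawAt N₀ σ ϖ d t` (★ №1 §1 verbatim: behind the datum, for every four-frame family, element datum at `N₀ d`, frames
`Γ_b`, `2k + d = Σn + 2`, `tv ∈ {0,2}`: `Σ_b n_tv(Γ_b) = 4(q^k−1)∕(q−1)`) follows from a `σ`-fixed unit `c` with the index-two dichotomy (NI2) and the eight-class model sum (MS)
at the same datum — by ★ p855115 `two_mul_sum_fixedVertexCount_eq_sum_signClasses` and division by two. [cite: Rogawski1990, §4.9 Prop. 4.9.1 (a) p. 55]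
[cite: LanglandsShelstad1987, §1.3] [cite: Serre1979, Ch. XIV §3] -/
theorem stableLawAt_of_normIndexTwo_of_modelSum (N₀ : ℕ → ℕ) (σ : K →+* K) (ϖ : K) (d t : ℕ)
    (hNI : ∃ c : K, σ c = c ∧ Valued.v c = 1 ∧ ∀ x : K, σ x = x → x ≠ 0 → (∃ z : K, z * σ z = x) ∨ ∃ z : K, z * σ z = c * x)
    (hMS : ∀ c : K, σ c = c → Valued.v c = 1 → (∀ x : K, σ x = x → x ≠ 0 → (∃ z : K, z * σ z = x) ∨ ∃ z : K, z * σ z = c * x) →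
      ∀ (α β : K) (n₁ n₂ n₃ : ℕ), IsElementDatum σ ϖ (N₀ d) α β n₁ n₂ n₃ →
      ∀ (T : GL (Fin 3) K), (T : Matrix (Fin 3) (Fin 3) K) = Matrix.diagonal ![α, β, 1] →
      ∀ (k : ℕ), 2 * k + d = n₁ + n₂ + n₃ + 2 → ∀ tv : ℕ, tv = 0 ∨ tv = 2 →
        ((∑ s : Fin 3 → Bool, {M : Submodule 𝒪[K] (Fin 3 → K) |
            IsVertexLattice σ ϖ (Matrix.diagonal fun i => if s i then c else (1 : K)) tv M ∧ mapGL T M = M}.ncard : ℕ) : ℚ) =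
          8 * ((Fintype.card 𝓀[K] : ℚ) ^ k - 1) / ((Fintype.card 𝓀[K] : ℚ) - 1)) :
    StableLawAt N₀ σ ϖ d t := by
  intro hD f hf α β n₁ n₂ n₃ hE Γ hΓ k hk tv htv
  obtain ⟨hσ, hvσ, hϖ, heven, -, -, -⟩ := hD
  obtain ⟨c, hσc, hvc, hdich⟩ := hNI
  -- `α, β` are units (`α·σα = 1`)
  have hα0 : α ≠ 0 := fun h => by have h1 := hE.1; rw [h, zero_mul] at h1; exact zero_ne_one h1
  have hβ0 : β ≠ 0 := fun h => by have h1 := hE.2.1; rw [h, zero_mul] at h1; exact zero_ne_one h1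
  -- the diagonal literal `T = diag(α, β, 1)` as a `GL₃` element
  let T : GL (Fin 3) K :=
    ⟨Matrix.diagonal ![α, β, 1], Matrix.diagonal ![α⁻¹, β⁻¹, 1],
      by rw [Matrix.diagonal_mul_diagonal, ← Matrix.diagonal_one]; congr 1; funext i; fin_cases i <;> simp [hα0, hβ0],
      by rw [Matrix.diagonal_mul_diagonal, ← Matrix.diagonal_one]; congr 1; funext i; fin_cases i <;> simp [hα0, hβ0]⟩
  have hT : (T : Matrix (Fin 3) (Fin 3) K) = Matrix.diagonal ![α, β, 1] := rfl
  have h2 := two_mul_sum_fixedVertexCount_eq_sum_signClasses hσ hvσ hϖ heven hσc hvc hdich hf α β T hT Γ hΓ tv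
  have hM := hMS c hσc hvc hdich α β n₁ n₂ n₃ hE T hT k hk tv htv
  have h2q : (2 : ℚ) * ((∑ b : Fin 4, fixedVertexCount σ ϖ tv (Γ b) : ℕ) : ℚ) =
      ((∑ s : Fin 3 → Bool, {M : Submodule 𝒪[K] (Fin 3 → K) |
          IsVertexLattice σ ϖ (Matrix.diagonal fun i => if s i then c else (1 : K)) tv M ∧ mapGL T M = M}.ncard : ℕ) : ℚ) := by
    exact_mod_cast h2
  rw [hM] at h2q
  linear_combination h2q / 2

/-- **THE FENCED FORM** — the §S heads' shape: `DyadicFence (StableLawAt N₀ σ ϖ d t)` from (NI2) + (MS) (the fence only weakens; ★ №1 `dyadicFence_of`).  At `N₀ = depthOfRecord`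
this is `stub_U3_stableLaw_RP`'s ∕ `_RU`'s conclusion at the datum, so the two heads reduce BY NAME to (NI2) + (MS). [cite: Rogawski1990, §4.9 Prop. 4.9.1 (a) p. 55] -/
theorem dyadicFence_stableLawAt_of_normIndexTwo_of_modelSum (N₀ : ℕ → ℕ) (σ : K →+* K) (ϖ : K) (d t : ℕ)
    (hNI : ∃ c : K, σ c = c ∧ Valued.v c = 1 ∧ ∀ x : K, σ x = x → x ≠ 0 → (∃ z : K, z * σ z = x) ∨ ∃ z : K, z * σ z = c * x)
    (hMS : ∀ c : K, σ c = c → Valued.v c = 1 → (∀ x : K, σ x = x → x ≠ 0 → (∃ z : K, z * σ z = x) ∨ ∃ z : K, z * σ z = c * x) →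
      ∀ (α β : K) (n₁ n₂ n₃ : ℕ), IsElementDatum σ ϖ (N₀ d) α β n₁ n₂ n₃ →
      ∀ (T : GL (Fin 3) K), (T : Matrix (Fin 3) (Fin 3) K) = Matrix.diagonal ![α, β, 1] →
      ∀ (k : ℕ), 2 * k + d = n₁ + n₂ + n₃ + 2 → ∀ tv : ℕ, tv = 0 ∨ tv = 2 →
        ((∑ s : Fin 3 → Bool, {M : Submodule 𝒪[K] (Fin 3 → K) |
            IsVertexLattice σ ϖ (Matrix.diagonal fun i => if s i then c else (1 : K)) tv M ∧ mapGL T M = M}.ncard : ℕ) : ℚ) =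
          8 * ((Fintype.card 𝓀[K] : ℚ) ^ k - 1) / ((Fintype.card 𝓀[K] : ℚ) - 1)) :
    DyadicFence (K := K) (StableLawAt N₀ σ ϖ d t) :=
  dyadicFence_of (stableLawAt_of_normIndexTwo_of_modelSum N₀ σ ϖ d t hNI hMS)

end Summit.HodgeConjecture.HodgeConjecture.Cruxes.H413.F0P3cDyRamStableLawOfModelSum

end
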